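/-
Copyright: the b2b-balaban T⁴-continuum CRUX team, row NE7b leaf lineage `t4-ne7b-formalise-leaf-06` (gen 159). Project licence.
-/
import Literature.MathematicalPhysics.QuantumFieldTheory.Balaban1983to89.B5Hk103ScalarZd

/-!
# THE ONE-SHOT SECTION IN THE MIXED CURRENCY — THE A-CERTIFICATE SOCKET: the block mean of `H_{T′}B` over `B(y″)` is EXACTLY `B(y″)`
# (`Q′H = 1`), so only the fluctuation is certified, by per-ROW `ℓ¹` bounds: `RMS_{B(y″)}(H_{T′}B) ≤ R·√(1 + ρ²)` (sup form, one `ρ` for the block),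
# `≤ R·√(1 + (n+1)^{−d}Σ_{p∈B(y″)}ρ(p)²)` (RMS form, a bound per row), and the window + tail splits `ρ = ρ_T + τ`
# (row NE7b, node U5c; PRICING-NE7b v124 F741 ∕ F745 (d) «A-cert … your call» and v126 F754 (b) «instrument 21, Ũ1»; [folklore] over `B5Hk103ScalarZd`)

Cell `pub-balaban`, sub-cell `t4`, spine estimate NE7b (`T4WeightBudget.RelWeightBound`; the cell's OWN estimate — NOT PRINTED in
[Bałaban 1983–89], NOT PROVED).  Crux-route work under `Spine/NE7b/` by leaf-06 (CRUX team (2), FREEZE (0) crux-prover clause).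
NOTHING of Bałaban's is named as a Lean object, valued or asserted; no `T4Continuum/Support` leaf typed; no `def`; zero `sorry`.
Import: `Literature.….B5Hk103ScalarZd` ONLY (the kernel `kerH`, `Q′H = 1` as `blockAvg_kerH`; `B6QGQDecay237.card_B` through it).  A SIBLING of
`…OneShotChartMixedNorm` (OSCMN: the SDP-dual socket §5) and `…OneShotChartMixedNormTail` (OSCMNT: the Minkowski glue) — both stay byte-identical
(400-line cap; OSCMNT's importer `…OneShotChartMixedNormZd` keeps its parent).

WHY.  The pricing desk's v124 F741 ∕ F745 (d) (refuter g103, to leaf-06): «the A-cert wants a socket with per-fine-site hypotheses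
`|kerH p y″ − 1| + Σ′_{y∈T, y≠y″}|kerH p y| ≤ ρ_T` + tail allowance + QH = 1 ⇒ `blockRMS(HB) ≤ R√(1 + (ρ_T + tail)²)` — your call»; v126 F754 (b)
(refuter g104): «the RMS form (Ũ1, the cheapest majorant by value) wants a per-row `ρ : X d → ℝ` and the conclusion
`R·√(1 + ((n+1)^d)⁻¹·Σ_{p∈B n y''} ρ p²)` … at M = 2 the two forms COINCIDE (K ≤ 1.8413 < 2); at M = 3: sup form 2.866 → 2.891 against the
letter 3, RMS form 2.329 → 2.347».  Compared with OSCMN §5's SDP-dual certificate `(w, λ)`: the leading `1` is EXACT here (no certificate spends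
on it) and per-row `ℓ¹` sums are interval-arithmetic friendly (no LDLᵀ).  THIS FILE types both forms on finite windows; the `T′ ↑ ℤ^d` limits
are `…OneShotChartMixedNormZd`'s.

WHAT IS PROVED (`a > 0`, `kerH n a p y` the section's kernel, `B n y″` the block of side `n+1` at `y″`, finite coarse windows `T ⊆ T′`; all [folklore]):
* §1 `sum_B_HB_eq` (for `y″ ∈ T′`: `Σ_{p∈B(y″)}(H_{T′}B)(p) = (n+1)^d·B(y″)` — `Q′H = 1` column by column, `B5Hk103ScalarZd.blockAvg_kerH`),
  `sum_sq_HB_eq_mean_add_fluct` (Pythagoras: `Σ_p(H_{T′}B)² = (n+1)^d·B(y″)² + Σ_p((H_{T′}B)(p) − B(y″))²`).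
* §2 **`blockRMS_HB_le_of_rowCertificate`** (`∀ p ∈ B(y″), |H(p,y″) − 1| + Σ_{y∈T′∖{y″}}|H(p,y)| ≤ ρ`, `|B| ≤ R` on `T′ ∋ y″` ⇒
  `RMS_{B(y″)}(H_{T′}B) ≤ R·√(1 + ρ²)`), **`blockRMS_HB_le_of_rowCertificate_add_tail`** (`y″ ∈ T ⊆ T′`, window rows `≤ ρ_T`, tail rows `≤ τ` ⇒
  `≤ R·√(1 + (ρ_T + τ)²)` — the desk's display).
* §3 **`blockRMS_HB_le_of_rowCertificateRMS`** (per-row `ρ(p)` ⇒ `≤ R·√(1 + (n+1)^{−d}Σ_{p∈B(y″)}ρ(p)²)`),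
  **`blockRMS_HB_le_of_rowCertificateRMS_add_tail`** (per-row window `ρ(p)` + per-row tail `τ(p)`).

HONEST: [folklore] bookkeeping; `ρ`, `τ` are DISPLAYED hypotheses — a balaban-calc certificate read here has ZERO kernel weight on Bałaban's estimate
(F733 (e)); no number enters; `ℤ^d`, finite windows, no torus; nothing of (A3) ∕ NC-NE7b-α.  BY-NAME EFFECT ON THE WALL: NONE.  NE7b NOT PRINTED ∕
NOT PROVED; spine PROVED 0∕9; rung (B)+1 on a FINITE torus — NOT infinite volume, NOT the mass gap, NOT Clay.  HONEST DEPENDENCY: continuum YM on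
T⁴ ⇐ BetaPertH ∧ nine spine estimates (0∕9 proved); BetaPertH ⇐ (D1) ∧ (D4) ∧ CAP+tail; G-an2-4 gates asym, D1 and NE2∕3∕4.
-/

set_option autoImplicit false

namespace Summit.QuantumFields.BalabanUV.T4Continuum.NE7b.OneShotChartACertificate

open Finset
open Literature.MathematicalPhysics.QuantumFieldTheory.Balaban1983to89
open B6QGQLower276 (X B)
open B5Hk103ScalarZd (kerH)

variable {d : ℕ}

/-! ## §1. The exact block mean `Q′H = 1` and Pythagoras on the block (PRICING-NE7b v124 F741 ∕ F745 (d): the desk's «A-cert», per-ROW `ℓ¹`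
hypotheses)

`Q′H = 1` column by column (`B5Hk103ScalarZd.blockAvg_kerH`: `(n+1)^{−d}Σ_{p∈B(y″)}H(p,y) = δ_{y″y}`) makes the block mean of `H_{T′}B` over `B(y″)`
EXACTLY `B(y″)` whenever `y″ ∈ T′`; Pythagoras on the block then separates the mean from the fluctuation, and the fluctuation at `p` is
`(H(p,y″) − 1)B(y″) + Σ_{y∈T′, y≠y″}H(p,y)B(y)`, bounded by `R·ρ` under the per-row certificate `|H(p,y″) − 1| + Σ_{y∈T′∖{y″}}|H(p,y)| ≤ ρ`.  Hence
`RMS_{B(y″)}(H_{T′}B) ≤ R·√(1 + ρ²)` — the desk's `R√(1 + (ρ_T + tail)²)` with `ρ = ρ_T + τ` split over a window `T ∋ y″` and its complement in `T′`.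
Row sums are interval-arithmetic friendly (no SDP); the leading `1` is exact. -/

/-- **THE BLOCK MEAN OF `H_{T′}B` IS EXACT**: for `y″ ∈ T′`, `Σ_{p∈B(y″)}Σ_{y∈T′}H(p,y)B(y) = (n+1)^d·B(y″)` (`Q′H = 1`, `blockAvg_kerH`). [folklore] -/
theorem sum_B_HB_eq (n : ℕ) {a : ℝ} (ha : 0 < a) (y'' : X d) {T' : Finset (X d)} (hy : y'' ∈ T') (Bf : X d → ℝ) :
    ∑ p ∈ B n y'', (∑ y ∈ T', kerH n a p y * Bf y) = ((n : ℝ) + 1) ^ d * Bf y'' := by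
  have hN : (0 : ℝ) < ((n : ℝ) + 1) ^ d := by positivity
  have hcol : ∀ y : X d, ∑ p ∈ B n y'', kerH n a p y = if y'' = y then ((n : ℝ) + 1) ^ d else 0 := by
    intro y
    have h := B5Hk103ScalarZd.blockAvg_kerH n ha y'' y
    rw [inv_mul_eq_div, div_eq_iff hN.ne'] at h
    rw [h]
    split_ifs <;> simp
  rw [Finset.sum_comm]
  calc ∑ y ∈ T', ∑ p ∈ B n y'', kerH n a p y * Bf y = ∑ y ∈ T', (∑ p ∈ B n y'', kerH n a p y) * Bf y := by
        refine Finset.sum_congr rfl fun y _ => ?_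
        rw [Finset.sum_mul]
    _ = ∑ y ∈ T', (if y'' = y then ((n : ℝ) + 1) ^ d else 0) * Bf y := by
        refine Finset.sum_congr rfl fun y _ => ?_
        rw [hcol y]
    _ = ((n : ℝ) + 1) ^ d * Bf y'' := by
        simp only [ite_mul, zero_mul, Finset.sum_ite_eq, if_pos hy]

/-- **PYTHAGORAS ON THE BLOCK WITH THE EXACT MEAN**: for `y″ ∈ T′`,
`Σ_{p∈B(y″)}(H_{T′}B)(p)² = (n+1)^d·B(y″)² + Σ_{p∈B(y″)}((H_{T′}B)(p) − B(y″))²`. [folklore] -/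
theorem sum_sq_HB_eq_mean_add_fluct (n : ℕ) {a : ℝ} (ha : 0 < a) (y'' : X d) {T' : Finset (X d)} (hy : y'' ∈ T') (Bf : X d → ℝ) :
    ∑ p ∈ B n y'', (∑ y ∈ T', kerH n a p y * Bf y) ^ 2
      = ((n : ℝ) + 1) ^ d * Bf y'' ^ 2 + ∑ p ∈ B n y'', ((∑ y ∈ T', kerH n a p y * Bf y) - Bf y'') ^ 2 := by
  have hmean := sum_B_HB_eq n ha y'' hy Bf
  have hcard : ∑ p ∈ B n y'', (Bf y'' ^ 2 : ℝ) = ((n : ℝ) + 1) ^ d * Bf y'' ^ 2 := by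
    rw [Finset.sum_const, nsmul_eq_mul, B6QGQDecay237.card_B n y'']
  have hexp : ∀ p : X d, ((∑ y ∈ T', kerH n a p y * Bf y) - Bf y'') ^ 2
      = (∑ y ∈ T', kerH n a p y * Bf y) ^ 2 - 2 * Bf y'' * (∑ y ∈ T', kerH n a p y * Bf y) + Bf y'' ^ 2 := fun p => by ring
  simp_rw [hexp]
  rw [Finset.sum_add_distrib, Finset.sum_sub_distrib, ← Finset.mul_sum, hmean, hcard]
  ring

/-! ## §2. The A-certificate socket, sup form (one `ρ` for all rows of the block) -/

/-- **THE A-CERTIFICATE SOCKET** (finite window `T′ ∋ y″`): if every ROW of the block satisfies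
`|H(p,y″) − 1| + Σ_{y∈T′∖{y″}}|H(p,y)| ≤ ρ` (`p ∈ B(y″)`) and `|B| ≤ R` on `T′`, then `RMS_{B(y″)}(H_{T′}B) ≤ R·√(1 + ρ²)` — the mean `B(y″)` is exact
(`Q′H = 1`), only the fluctuation is certified. [folklore] -/
theorem blockRMS_HB_le_of_rowCertificate (n : ℕ) {a : ℝ} (ha : 0 < a) (y'' : X d) {T' : Finset (X d)} (hy : y'' ∈ T') {ρ : ℝ}
    (hrow : ∀ p ∈ B n y'', |kerH n a p y'' - 1| + ∑ y ∈ T'.erase y'', |kerH n a p y| ≤ ρ)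
    (Bf : X d → ℝ) {R : ℝ} (hR : 0 ≤ R) (hB : ∀ y ∈ T', |Bf y| ≤ R) :
    Real.sqrt ((((n : ℝ) + 1) ^ d)⁻¹ * ∑ p ∈ B n y'', (∑ y ∈ T', kerH n a p y * Bf y) ^ 2)
      ≤ R * Real.sqrt (1 + ρ ^ 2) := by
  classical
  have hN : (0 : ℝ) < ((n : ℝ) + 1) ^ d := by positivity
  -- the fluctuation at `p`, pointwise
  have hfl : ∀ p ∈ B n y'', |(∑ y ∈ T', kerH n a p y * Bf y) - Bf y''| ≤ R * ρ := by
    intro p hp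
    have hsplit : (∑ y ∈ T', kerH n a p y * Bf y) - Bf y''
        = (kerH n a p y'' - 1) * Bf y'' + ∑ y ∈ T'.erase y'', kerH n a p y * Bf y := by
      rw [← Finset.add_sum_erase T' (fun y => kerH n a p y * Bf y) hy]; ring
    rw [hsplit]
    calc |(kerH n a p y'' - 1) * Bf y'' + ∑ y ∈ T'.erase y'', kerH n a p y * Bf y|
        ≤ |(kerH n a p y'' - 1) * Bf y''| + |∑ y ∈ T'.erase y'', kerH n a p y * Bf y| := abs_add_le _ _
      _ ≤ |kerH n a p y'' - 1| * R + ∑ y ∈ T'.erase y'', |kerH n a p y| * R := by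
          refine add_le_add ?_ ((Finset.abs_sum_le_sum_abs _ _).trans (Finset.sum_le_sum fun y hy' => ?_))
          · rw [abs_mul]; exact mul_le_mul_of_nonneg_left (hB y'' hy) (abs_nonneg _)
          · rw [abs_mul]; exact mul_le_mul_of_nonneg_left (hB y (Finset.mem_of_mem_erase hy')) (abs_nonneg _)
      _ = (|kerH n a p y'' - 1| + ∑ y ∈ T'.erase y'', |kerH n a p y|) * R := by rw [add_mul, Finset.sum_mul]
      _ ≤ ρ * R := mul_le_mul_of_nonneg_right (hrow p hp) hR
      _ = R * ρ := mul_comm _ _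
  -- Pythagoras + the two bounds
  have hB0 : Bf y'' ^ 2 ≤ R ^ 2 := by
    rw [← sq_abs]; exact pow_le_pow_left₀ (abs_nonneg _) (hB y'' hy) 2
  have hfl2 : ∑ p ∈ B n y'', ((∑ y ∈ T', kerH n a p y * Bf y) - Bf y'') ^ 2 ≤ ((n : ℝ) + 1) ^ d * (R * ρ) ^ 2 := by
    calc ∑ p ∈ B n y'', ((∑ y ∈ T', kerH n a p y * Bf y) - Bf y'') ^ 2 ≤ ∑ p ∈ B n y'', (R * ρ) ^ 2 := by
          refine Finset.sum_le_sum fun p hp => ?_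
          rw [← sq_abs]; exact pow_le_pow_left₀ (abs_nonneg _) (hfl p hp) 2
      _ = ((n : ℝ) + 1) ^ d * (R * ρ) ^ 2 := by rw [Finset.sum_const, nsmul_eq_mul, B6QGQDecay237.card_B n y'']
  have hsum : (((n : ℝ) + 1) ^ d)⁻¹ * ∑ p ∈ B n y'', (∑ y ∈ T', kerH n a p y * Bf y) ^ 2 ≤ (R * Real.sqrt (1 + ρ ^ 2)) ^ 2 := by
    rw [sum_sq_HB_eq_mean_add_fluct n ha y'' hy Bf, inv_mul_le_iff₀ hN, mul_pow, Real.sq_sqrt (by positivity)]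
    nlinarith [hB0, hfl2, hN]
  calc Real.sqrt ((((n : ℝ) + 1) ^ d)⁻¹ * ∑ p ∈ B n y'', (∑ y ∈ T', kerH n a p y * Bf y) ^ 2)
      ≤ Real.sqrt ((R * Real.sqrt (1 + ρ ^ 2)) ^ 2) := Real.sqrt_le_sqrt hsum
    _ = R * Real.sqrt (1 + ρ ^ 2) := Real.sqrt_sq (by positivity)

/-- **THE A-CERTIFICATE SOCKET, WINDOW + TAIL FORM** (the desk's display `R√(1 + (ρ_T + τ)²)`): `y″ ∈ T ⊆ T′`, per-row window certificate
`|H(p,y″) − 1| + Σ_{y∈T∖{y″}}|H(p,y)| ≤ ρ_T` and per-row tail allowance `Σ_{y∈T′∖T}|H(p,y)| ≤ τ` on the block, `|B| ≤ R` on `T′` ⇒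
`RMS_{B(y″)}(H_{T′}B) ≤ R·√(1 + (ρ_T + τ)²)`. [folklore] -/
theorem blockRMS_HB_le_of_rowCertificate_add_tail (n : ℕ) {a : ℝ} (ha : 0 < a) (y'' : X d) {T T' : Finset (X d)} (hT : T ⊆ T')
    (hy : y'' ∈ T) {ρ τ : ℝ}
    (hrow : ∀ p ∈ B n y'', |kerH n a p y'' - 1| + ∑ y ∈ T.erase y'', |kerH n a p y| ≤ ρ)
    (htail : ∀ p ∈ B n y'', ∑ y ∈ T' \ T, |kerH n a p y| ≤ τ)
    (Bf : X d → ℝ) {R : ℝ} (hR : 0 ≤ R) (hB : ∀ y ∈ T', |Bf y| ≤ R) :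
    Real.sqrt ((((n : ℝ) + 1) ^ d)⁻¹ * ∑ p ∈ B n y'', (∑ y ∈ T', kerH n a p y * Bf y) ^ 2)
      ≤ R * Real.sqrt (1 + (ρ + τ) ^ 2) := by
  classical
  refine blockRMS_HB_le_of_rowCertificate n ha y'' (hT hy) (fun p hp => ?_) Bf hR hB
  -- `T′∖{y″} = (T∖{y″}) ⊔ (T′∖T)`
  have hsplit : T'.erase y'' = (T.erase y'') ∪ (T' \ T) := by
    ext y
    simp only [Finset.mem_erase, Finset.mem_union, Finset.mem_sdiff]
    constructor
    · rintro ⟨hne, hyT'⟩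
      by_cases h : y ∈ T
      · exact Or.inl ⟨hne, h⟩
      · exact Or.inr ⟨hyT', h⟩
    · rintro (⟨hne, hyT⟩ | ⟨hyT', hynT⟩)
      · exact ⟨hne, hT hyT⟩
      · exact ⟨fun h => hynT (h ▸ hy), hyT'⟩
  have hdisj : Disjoint (T.erase y'') (T' \ T) :=
    Finset.disjoint_left.mpr fun y hyT hyS => (Finset.mem_sdiff.mp hyS).2 (Finset.mem_of_mem_erase hyT)
  rw [hsplit, Finset.sum_union hdisj, ← add_assoc]
  exact add_le_add (hrow p hp) (htail p hp)

/-! ## §3. The A-certificate socket, RMS form (a row bound `ρ(p)` per fine site; the desk's instrument 21 «Ũ1») -/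

/-- **THE A-CERTIFICATE SOCKET, RMS FORM** (PRICING-NE7b v126 F754 (b), the desk's instrument 21 «Ũ1»: the cheapest majorant by value): a per-ROW
certificate `ρ : ℤ^d → ℝ` — `|H(p,y″) − 1| + Σ_{y∈T′∖{y″}}|H(p,y)| ≤ ρ(p)` for `p ∈ B(y″)` — and `|B| ≤ R` on `T′ ∋ y″` give
`RMS_{B(y″)}(H_{T′}B) ≤ R·√(1 + (n+1)^{−d}Σ_{p∈B(y″)}ρ(p)²)`: the exact mean plus the ROOT-MEAN-SQUARE of the row bounds (≤ the sup form's `√(1 + (max ρ)²)`;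
at `M = 2` the two coincide, at `M = 3` the desk reports `2.33` against `2.87` for the sup form, letter `3`). [folklore] -/
theorem blockRMS_HB_le_of_rowCertificateRMS (n : ℕ) {a : ℝ} (ha : 0 < a) (y'' : X d) {T' : Finset (X d)} (hy : y'' ∈ T') (ρ : X d → ℝ)
    (hrow : ∀ p ∈ B n y'', |kerH n a p y'' - 1| + ∑ y ∈ T'.erase y'', |kerH n a p y| ≤ ρ p)
    (Bf : X d → ℝ) {R : ℝ} (hR : 0 ≤ R) (hB : ∀ y ∈ T', |Bf y| ≤ R) :
    Real.sqrt ((((n : ℝ) + 1) ^ d)⁻¹ * ∑ p ∈ B n y'', (∑ y ∈ T', kerH n a p y * Bf y) ^ 2)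
      ≤ R * Real.sqrt (1 + (((n : ℝ) + 1) ^ d)⁻¹ * ∑ p ∈ B n y'', ρ p ^ 2) := by
  classical
  have hN : (0 : ℝ) < ((n : ℝ) + 1) ^ d := by positivity
  have hNi : 0 ≤ (((n : ℝ) + 1) ^ d)⁻¹ := inv_nonneg.mpr hN.le
  -- the fluctuation at `p`, pointwise, with the per-row bound
  have hfl : ∀ p ∈ B n y'', |(∑ y ∈ T', kerH n a p y * Bf y) - Bf y''| ≤ R * ρ p := by
    intro p hp
    have hsplit : (∑ y ∈ T', kerH n a p y * Bf y) - Bf y''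
        = (kerH n a p y'' - 1) * Bf y'' + ∑ y ∈ T'.erase y'', kerH n a p y * Bf y := by
      rw [← Finset.add_sum_erase T' (fun y => kerH n a p y * Bf y) hy]; ring
    rw [hsplit]
    calc |(kerH n a p y'' - 1) * Bf y'' + ∑ y ∈ T'.erase y'', kerH n a p y * Bf y|
        ≤ |(kerH n a p y'' - 1) * Bf y''| + |∑ y ∈ T'.erase y'', kerH n a p y * Bf y| := abs_add_le _ _
      _ ≤ |kerH n a p y'' - 1| * R + ∑ y ∈ T'.erase y'', |kerH n a p y| * R := by
          refine add_le_add ?_ ((Finset.abs_sum_le_sum_abs _ _).trans (Finset.sum_le_sum fun y hy' => ?_))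
          · rw [abs_mul]; exact mul_le_mul_of_nonneg_left (hB y'' hy) (abs_nonneg _)
          · rw [abs_mul]; exact mul_le_mul_of_nonneg_left (hB y (Finset.mem_of_mem_erase hy')) (abs_nonneg _)
      _ = (|kerH n a p y'' - 1| + ∑ y ∈ T'.erase y'', |kerH n a p y|) * R := by rw [add_mul, Finset.sum_mul]
      _ ≤ ρ p * R := mul_le_mul_of_nonneg_right (hrow p hp) hR
      _ = R * ρ p := mul_comm _ _
  have hB0 : Bf y'' ^ 2 ≤ R ^ 2 := by
    rw [← sq_abs]; exact pow_le_pow_left₀ (abs_nonneg _) (hB y'' hy) 2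
  have hfl2 : ∑ p ∈ B n y'', ((∑ y ∈ T', kerH n a p y * Bf y) - Bf y'') ^ 2 ≤ R ^ 2 * ∑ p ∈ B n y'', ρ p ^ 2 := by
    rw [Finset.mul_sum]
    refine Finset.sum_le_sum fun p hp => ?_
    rw [← sq_abs, ← mul_pow]
    exact pow_le_pow_left₀ (abs_nonneg _) (hfl p hp) 2
  have hρ0 : 0 ≤ ∑ p ∈ B n y'', ρ p ^ 2 := Finset.sum_nonneg fun _ _ => sq_nonneg _
  have hsum : (((n : ℝ) + 1) ^ d)⁻¹ * ∑ p ∈ B n y'', (∑ y ∈ T', kerH n a p y * Bf y) ^ 2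
      ≤ (R * Real.sqrt (1 + (((n : ℝ) + 1) ^ d)⁻¹ * ∑ p ∈ B n y'', ρ p ^ 2)) ^ 2 := by
    rw [sum_sq_HB_eq_mean_add_fluct n ha y'' hy Bf, mul_pow, Real.sq_sqrt (by positivity), mul_add, mul_add,
      ← mul_assoc, inv_mul_cancel₀ hN.ne', one_mul, mul_one]
    have h2 : (((n : ℝ) + 1) ^ d)⁻¹ * ∑ p ∈ B n y'', ((∑ y ∈ T', kerH n a p y * Bf y) - Bf y'') ^ 2
        ≤ R ^ 2 * ((((n : ℝ) + 1) ^ d)⁻¹ * ∑ p ∈ B n y'', ρ p ^ 2) := by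
      calc (((n : ℝ) + 1) ^ d)⁻¹ * ∑ p ∈ B n y'', ((∑ y ∈ T', kerH n a p y * Bf y) - Bf y'') ^ 2
          ≤ (((n : ℝ) + 1) ^ d)⁻¹ * (R ^ 2 * ∑ p ∈ B n y'', ρ p ^ 2) := mul_le_mul_of_nonneg_left hfl2 hNi
        _ = R ^ 2 * ((((n : ℝ) + 1) ^ d)⁻¹ * ∑ p ∈ B n y'', ρ p ^ 2) := by ring
    linarith [hB0, h2]
  calc Real.sqrt ((((n : ℝ) + 1) ^ d)⁻¹ * ∑ p ∈ B n y'', (∑ y ∈ T', kerH n a p y * Bf y) ^ 2)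
      ≤ Real.sqrt ((R * Real.sqrt (1 + (((n : ℝ) + 1) ^ d)⁻¹ * ∑ p ∈ B n y'', ρ p ^ 2)) ^ 2) := Real.sqrt_le_sqrt hsum
    _ = R * Real.sqrt (1 + (((n : ℝ) + 1) ^ d)⁻¹ * ∑ p ∈ B n y'', ρ p ^ 2) := Real.sqrt_sq (by positivity)

/-- **THE A-CERTIFICATE SOCKET, RMS FORM, WINDOW + TAIL**: `y″ ∈ T ⊆ T′`, per-row window certificate `ρ(p)` on `T∖{y″}` and per-row tail
allowance `τ(p) ≥ Σ_{y∈T′∖T}|H(p,y)|`, `|B| ≤ R` on `T′` ⇒ `RMS_{B(y″)}(H_{T′}B) ≤ R·√(1 + (n+1)^{−d}Σ_{p∈B(y″)}(ρ(p) + τ(p))²)`. [folklore] -/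
theorem blockRMS_HB_le_of_rowCertificateRMS_add_tail (n : ℕ) {a : ℝ} (ha : 0 < a) (y'' : X d) {T T' : Finset (X d)} (hT : T ⊆ T')
    (hy : y'' ∈ T) (ρ τ : X d → ℝ)
    (hrow : ∀ p ∈ B n y'', |kerH n a p y'' - 1| + ∑ y ∈ T.erase y'', |kerH n a p y| ≤ ρ p)
    (htail : ∀ p ∈ B n y'', ∑ y ∈ T' \ T, |kerH n a p y| ≤ τ p)
    (Bf : X d → ℝ) {R : ℝ} (hR : 0 ≤ R) (hB : ∀ y ∈ T', |Bf y| ≤ R) :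
    Real.sqrt ((((n : ℝ) + 1) ^ d)⁻¹ * ∑ p ∈ B n y'', (∑ y ∈ T', kerH n a p y * Bf y) ^ 2)
      ≤ R * Real.sqrt (1 + (((n : ℝ) + 1) ^ d)⁻¹ * ∑ p ∈ B n y'', (ρ p + τ p) ^ 2) := by
  classical
  refine blockRMS_HB_le_of_rowCertificateRMS n ha y'' (hT hy) (fun p => ρ p + τ p) (fun p hp => ?_) Bf hR hB
  have hsplit : T'.erase y'' = (T.erase y'') ∪ (T' \ T) := by
    ext y
    simp only [Finset.mem_erase, Finset.mem_union, Finset.mem_sdiff]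
    constructor
    · rintro ⟨hne, hyT'⟩
      by_cases h : y ∈ T
      · exact Or.inl ⟨hne, h⟩
      · exact Or.inr ⟨hyT', h⟩
    · rintro (⟨hne, hyT⟩ | ⟨hyT', hynT⟩)
      · exact ⟨hne, hT hyT⟩
      · exact ⟨fun h => hynT (h ▸ hy), hyT'⟩
  have hdisj : Disjoint (T.erase y'') (T' \ T) :=
    Finset.disjoint_left.mpr fun y hyT hyS => (Finset.mem_sdiff.mp hyS).2 (Finset.mem_of_mem_erase hyT)
  rw [hsplit, Finset.sum_union hdisj, ← add_assoc]
  exact add_le_add (hrow p hp) (htail p hp)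

end Summit.QuantumFields.BalabanUV.T4Continuum.NE7b.OneShotChartACertificate
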